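import Summits.BirchSwinnertonDyer.BirchSwinnertonDyer.Theses.ErratumRoadFive
import HarnessLib

/-!
# Route `ErratumRoadFive` — the Assembly item, discharged

Cell `bsd-stepL` (run/shared/lean/pub/bsd-stepL/), seat `bsd-stepL-bdp` (prover), D-0059 ∕ D-0061
rung-K2 route `route-BirchSwinnertonDyer-ErratumRoadFive` (planner g19; leaf
`Summit.BirchSwinnertonDyer.Rank1Residual.X11b.MultiplicativeRankOne`, p404842; import hub p405590).

The route's `Assembly` item (`stmt-BirchSwinnertonDyer-19067`) is the implication
`OpenInputIMC → EulerHalfOffLocus → ShimuraDisplays → X11aLowerHalf → NonSurjCorner →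
PublishedInputsFive → X11b.MultiplicativeRankOne`: pure re-plumbing of the cell's kernel record
`P2.bsdp_of_onTree_endState` (X11b/BDPRouteEndState.lean §3) through the leaf glue
`X11b.multiplicativeRankOne_of_endState` (X11b/RungK2Leaves.lean §2). This file proves it with the
SAME term the route's deciding theorem `closes` uses inline (planner's `gluetest-ErratumRoadFive.lean`,
farm rc 0): destructure the support conjunction into its fifteen named facts and apply the glue to
the five cruxes. Nothing mathematical is claimed beyond the kernel record; the five cruxes and the
fifteen published facts remain hypotheses of the implication. HONEST FRAMING: this closes the
ASSEMBLY item only — no crux, no pair of class X11b, no census word.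

References: [Castella2018] F. Castella, Camb. J. Math. 6 (2018), §5; [JetchevSkinnerWan2017] §7.4.
-/

namespace Summit.BirchSwinnertonDyer.BirchSwinnertonDyer.Theorems

/-- **The Assembly item of route `ErratumRoadFive` holds**: the five cruxes `OpenInputIMC`,
`EulerHalfOffLocus`, `ShimuraDisplays`, `X11aLowerHalf`, `NonSurjCorner` and the support conjunction
`PublishedInputsFive` imply the rung-K2 leaf `X11b.MultiplicativeRankOne` — by the tree's kernel glue
`X11b.multiplicativeRankOne_of_endState` (= `P2.bsdp_of_onTree_endState` re-plumbed), the support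
conjunction being destructured into its fifteen named facts. Same term as the route's `closes`.
[cite: Castella2018, §5 (arXiv:1704.06608 p. 12) (assembly shape at p ∣ N)]
[cite: JetchevSkinnerWan2017, §7.4 (arXiv:1512.06894 pp. 29–31)] -/
theorem erratumRoadFive_assembly_holds :
    Summit.BirchSwinnertonDyer.BirchSwinnertonDyer.Theses.ErratumRoadFive.Assembly := by
  intro g₁ g₂ g₃ g₄ g₅ g₆
  obtain ⟨hGZ, hKo, hB, hSk, hWu, hGZK, hmod, hnf, hHL, hFHs, hMaz, hBDMTV, hFH, hPT, hEP⟩ := g₆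
  exact Summit.BirchSwinnertonDyer.Rank1Residual.X11b.multiplicativeRankOne_of_endState hGZ hKo hB hSk
    hWu hGZK hmod hnf hHL hFHs hMaz hBDMTV hFH hPT hEP g₁ g₂ g₃ g₄ g₅

end Summit.BirchSwinnertonDyer.BirchSwinnertonDyer.Theorems
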